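import Mathlib
import Summits.ValiantsHypothesis.ValiantsHypothesis.Theorems.BarrierLeverPartitionMinorsHitByVPHiddenStatesCoStarLeaves

/-!
# Route BarrierLever — item `PartitionMinorsHitByVP` (stmt-ValiantsHypothesis-19717), line `hidden-states`:
# THE CO-STAR RECURSION, part 2/3 — sub-cube co-star instances with an up-set of `c + 1 ≤ 5` missing rows are generically good, in EVERY dimension

Helper file (`--supports stmt-ValiantsHypothesis-19717`; cell valiant-natproofs, rung V4, 𝒟-side door (c), registered line
`Cruxes/PartitionMinorsHitByVP/Lines/hidden_states.lean` v7; prover seat val-np-p6 gen 11). Definition-free; closes NO item.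

A SUB-CUBE CO-STAR INSTANCE (one piece `p₀`): a coordinate block `Y ⊆ Fin n` and a state block `Q ⊆ Fin K` of the same size `d`, special
states `Qs ⊆ Q` (`|Qs| = c`), an UP-CLOSED family `𝒜` of `c + 1` subsets of `Y` (the missing rows); the rows are ALL other subsets of `Y`
(injectively enumerated, in any order) and the columns are all subsets of `Q` except `Q` and the co-singletons `Q ∖ {q}`, `q ∈ Qs` (any order).
This is exactly «the co-star `T_{d,c}` against a LOWER row family of its size», relativised to blocks so that an induction on `d` can run
inside fixed ambient types.

* `coStar_subcube_symGood` — **THE RECURSION THEOREM.** Every sub-cube co-star instance with `c ≤ 3` is generically good (`symDet ≠ 0`), in every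
  dimension `d`; and the same for `c ≤ 4` GIVEN the combinatorial fact `SatFour` («an up-closed family of 5 subsets of a 4-set has a coordinate
  avoided by exactly one member», proved in part 3/3). Induction on `d` (memo val-np-p6 g10 §9, made rigorous): by `exists_coord_avoid_le_one`
  some `x ∈ Y` is avoided by at most one missing row; if by exactly one (necessarily `Y ∖ x`), stack on `x` with a SPECIAL marker (R2′: zero child =
  cube-minus-top tiling, link child = instance `(d−1, c−1)`); if by none and a non-special state exists, stack with it (R1: zero child = full-cube
  tiling, link child = instance `(d−1, c)`); `c = 0` is the cube-minus-top tiling itself; the saturated leaves `c = d ≤ 3` are free columns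
  (`|J| ≤ d − 2 ≤ 1`), and `c = d = 4` is never stuck (`SatFour`). Tools: `symGood_of_stack_pred`, `symGood_subcube_full/top`,
  `symGood_of_cols_card_le_one` (part 1/3).
* Bookkeeping: link family `𝒜ₓ = {A ∖ x : x ∈ A ∈ 𝒜}`, ranges of link rows / columns, the two counting identities.

WHAT THIS IS NOT: the all-`u` co-star conjecture is untouched for `c ≥ 3`; `c ≥ 5` saturated instances can be STUCK for facet stacks (memo
g10 §9: `{123,23,13,12,3,1} ⊕ {4,5}` in dimension 5) and need certificates; no stub of the line is closed; nothing on crux 14610 or VP ≠ VNP.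
-/

set_option linter.dupNamespace false

namespace Summit.ValiantsHypothesis.ValiantsHypothesis.Theorems.BarrierLever.HiddenStates

open Finset Matrix MvPolynomial

noncomputable section

namespace SymbJoin

variable {n m K r : ℕ}

/-! ## 1. The link family `𝒜ₓ` -/

/-- Membership in the link family: `T ∈ 𝒜ₓ ↔ insert x T ∈ 𝒜 ∧ x ∉ T`. -/
theorem mem_linkFamily_iff (𝒜 : Finset (Finset (Fin n))) (x : Fin n) (T : Finset (Fin n)) :
    T ∈ (𝒜.filter fun A => x ∈ A).image (fun A => A.erase x) ↔ insert x T ∈ 𝒜 ∧ x ∉ T := by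
  classical
  constructor
  · intro hT
    obtain ⟨A, hA, rfl⟩ := Finset.mem_image.mp hT
    rw [Finset.mem_filter] at hA
    rw [Finset.insert_erase hA.2]
    exact ⟨hA.1, Finset.notMem_erase x A⟩
  · rintro ⟨hA, hxT⟩
    exact Finset.mem_image.mpr ⟨insert x T, Finset.mem_filter.mpr ⟨hA, Finset.mem_insert_self x T⟩, Finset.erase_insert hxT⟩

/-- The link family lives in the facet `Y ∖ x`. -/
theorem linkFamily_subset (Y : Finset (Fin n)) (𝒜 : Finset (Finset (Fin n))) (x : Fin n) (h𝒜Y : ∀ A ∈ 𝒜, A ⊆ Y) :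
    ∀ T ∈ (𝒜.filter fun A => x ∈ A).image (fun A => A.erase x), T ⊆ Y.erase x := by
  intro T hT
  obtain ⟨A, hA, rfl⟩ := Finset.mem_image.mp hT
  exact Finset.erase_subset_erase x (h𝒜Y A (Finset.mem_filter.mp hA).1)

/-- The link family of an up-closed family is up-closed in the facet. -/
theorem linkFamily_up (Y : Finset (Fin n)) (𝒜 : Finset (Finset (Fin n))) (x : Fin n) (hx : x ∈ Y)
    (hup : ∀ A ∈ 𝒜, ∀ A', A ⊆ A' → A' ⊆ Y → A' ∈ 𝒜) :
    ∀ T ∈ (𝒜.filter fun A => x ∈ A).image (fun A => A.erase x), ∀ T', T ⊆ T' → T' ⊆ Y.erase x →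
      T' ∈ (𝒜.filter fun A => x ∈ A).image (fun A => A.erase x) := by
  classical
  intro T hT T' hTT' hT'
  rw [mem_linkFamily_iff] at hT ⊢
  have hxT' : x ∉ T' := fun h => Finset.notMem_erase x Y (hT' h)
  refine ⟨hup _ hT.1 _ (Finset.insert_subset_insert x hTT') ?_, hxT'⟩
  exact Finset.insert_subset hx ((hT'.trans (Finset.erase_subset x Y)))

/-- The link family has as many members as there are members through `x`. -/
theorem linkFamily_card (𝒜 : Finset (Finset (Fin n))) (x : Fin n) :
    ((𝒜.filter fun A => x ∈ A).image (fun A => A.erase x)).card = (𝒜.filter fun A => x ∈ A).card := by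
  classical
  apply Finset.card_image_of_injOn
  intro A hA A' hA' hAA
  simp only [Finset.coe_filter, Set.mem_setOf_eq] at hA hA'
  simp only at hAA
  rw [← Finset.insert_erase hA.2, ← Finset.insert_erase hA'.2, hAA]

/-! ## 2. Ranges of the link rows and link columns -/

/-- **Link rows.** Erasing `x` from the rows through `x` of a sub-cube instance `(Y, 𝒜)` enumerates exactly the subsets of `Y ∖ x` outside the
link family, injectively. -/
theorem linkRows_range {r₁ : ℕ} (Y : Finset (Fin n)) (𝒜 : Finset (Finset (Fin n))) (x : Fin n) (hx : x ∈ Y)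
    (u : Fin r → Finset (Fin n)) (hu : Function.Injective u) (hrows : ∀ S, (∃ i, u i = S) ↔ S ⊆ Y ∧ S ∉ 𝒜)
    (f : Fin r₁ → Fin r) (hf : Function.Injective f) (hfx : ∀ j, x ∈ u (f j)) (hfs : ∀ i, x ∈ u i → ∃ j, f j = i) :
    Function.Injective (fun j => (u (f j)).erase x) ∧
      ∀ T, (∃ j, (u (f j)).erase x = T) ↔
        T ⊆ Y.erase x ∧ T ∉ (𝒜.filter fun A => x ∈ A).image (fun A => A.erase x) := by
  classical
  refine ⟨fun j j' hjj => hf (hu ?_), fun T => ⟨?_, ?_⟩⟩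
  · simp only at hjj
    rw [← Finset.insert_erase (hfx j), ← Finset.insert_erase (hfx j'), hjj]
  · rintro ⟨j, rfl⟩
    obtain ⟨hSY, hS𝒜⟩ := (hrows _).mp ⟨f j, rfl⟩
    refine ⟨Finset.erase_subset_erase x hSY, fun hmem => hS𝒜 ?_⟩
    rw [mem_linkFamily_iff, Finset.insert_erase (hfx j)] at hmem
    exact hmem.1
  · rintro ⟨hTY, hT𝒜⟩
    have hxT : x ∉ T := fun h => Finset.notMem_erase x Y (hTY h)
    have hrow : insert x T ⊆ Y ∧ insert x T ∉ 𝒜 := by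
      refine ⟨Finset.insert_subset hx (hTY.trans (Finset.erase_subset x Y)), fun hA => hT𝒜 ?_⟩
      rw [mem_linkFamily_iff]; exact ⟨hA, hxT⟩
    obtain ⟨i, hi⟩ := (hrows _).mpr hrow
    obtain ⟨j, rfl⟩ := hfs i (by rw [hi]; exact Finset.mem_insert_self x T)
    refine ⟨j, ?_⟩
    simp only [hi, Finset.erase_insert hxT]

/-- **Link columns.** Erasing the marker `q ∈ Q` from the columns through `q` of the co-star column family `(Q, Qs)` enumerates exactly the
co-star column family `(Q ∖ q, Qs ∖ q)`, injectively. -/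
theorem linkCols_range {r₁ : ℕ} (Q Qs : Finset (Fin K)) (q : Fin K) (hq : q ∈ Q)
    (cols : Fin r → Finset (Fin K)) (hcols : Function.Injective cols)
    (hcolr : ∀ J, (∃ k, cols k = J) ↔ J ⊆ Q ∧ J ≠ Q ∧ ∀ q' ∈ Qs, J ≠ Q.erase q')
    (g : Fin r₁ → Fin r) (hg : Function.Injective g) (hgq : ∀ j, q ∈ cols (g j)) (hgs : ∀ k, q ∈ cols k → ∃ j, g j = k) :
    Function.Injective (fun j => (cols (g j)).erase q) ∧
      ∀ J, (∃ j, (cols (g j)).erase q = J) ↔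
        J ⊆ Q.erase q ∧ J ≠ Q.erase q ∧ ∀ q' ∈ Qs.erase q, J ≠ (Q.erase q).erase q' := by
  classical
  have hcomm : ∀ q', q' ≠ q → insert q ((Q.erase q).erase q') = Q.erase q' := by
    intro q' hq'
    rw [Finset.erase_right_comm, Finset.insert_erase (Finset.mem_erase.mpr ⟨hq'.symm, hq⟩)]
  refine ⟨fun j j' hjj => hg (hcols ?_), fun J => ⟨?_, ?_⟩⟩
  · simp only at hjj
    rw [← Finset.insert_erase (hgq j), ← Finset.insert_erase (hgq j'), hjj]
  · rintro ⟨j, rfl⟩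
    obtain ⟨hCQ, hCne, hCs⟩ := (hcolr _).mp ⟨g j, rfl⟩
    refine ⟨Finset.erase_subset_erase q hCQ, fun hEq => hCne ?_, fun q' hq' hEq => ?_⟩
    · rw [← Finset.insert_erase (hgq j), hEq, Finset.insert_erase hq]
    · obtain ⟨hq'q, hq's⟩ := Finset.mem_erase.mp hq'
      apply hCs q' hq's
      rw [← Finset.insert_erase (hgq j), hEq, hcomm q' hq'q]
  · rintro ⟨hJQ, hJne, hJs⟩
    have hqJ : q ∉ J := fun h => Finset.notMem_erase q Q (hJQ h)
    have hcol : insert q J ⊆ Q ∧ insert q J ≠ Q ∧ ∀ q' ∈ Qs, insert q J ≠ Q.erase q' := by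
      refine ⟨Finset.insert_subset hq (hJQ.trans (Finset.erase_subset q Q)), fun hEq => hJne ?_, fun q' hq' hEq => ?_⟩
      · rw [← hEq, Finset.erase_insert hqJ]
      · by_cases hq'q : q' = q
        · rw [hq'q] at hEq
          have : q ∈ Q.erase q := hEq ▸ Finset.mem_insert_self q J
          exact Finset.notMem_erase q Q this
        · apply hJs q' (Finset.mem_erase.mpr ⟨hq'q, hq'⟩)
          rw [← Finset.erase_insert hqJ, hEq, Finset.erase_right_comm]
    obtain ⟨k, hk⟩ := (hcolr _).mpr hcol
    obtain ⟨j, rfl⟩ := hgs k (by rw [hk]; exact Finset.mem_insert_self q J)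
    refine ⟨j, ?_⟩
    simp only [hk, Finset.erase_insert hqJ]

/-! ## 3. The two counting identities -/

/-- Rows avoiding `x` plus missing rows avoiding `x` fill the facet: `#{i : x ∉ u i} + #{A ∈ 𝒜 : x ∉ A} = 2^{|Y|−1}`. -/
theorem card_rows_avoid (Y : Finset (Fin n)) (𝒜 : Finset (Finset (Fin n))) (x : Fin n) (hx : x ∈ Y) (h𝒜Y : ∀ A ∈ 𝒜, A ⊆ Y)
    (u : Fin r → Finset (Fin n)) (hu : Function.Injective u) (hrows : ∀ S, (∃ i, u i = S) ↔ S ⊆ Y ∧ S ∉ 𝒜) :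
    (Finset.univ.filter fun i => x ∉ u i).card + (𝒜.filter fun A => x ∉ A).card = 2 ^ (Y.card - 1) := by
  classical
  have himg : (Finset.univ.filter fun i => x ∉ u i).image u = (Y.erase x).powerset.filter fun S => S ∉ 𝒜 := by
    ext S
    simp only [Finset.mem_image, Finset.mem_filter, Finset.mem_univ, true_and, Finset.mem_powerset]
    constructor
    · rintro ⟨i, hxi, rfl⟩
      obtain ⟨hSY, hS𝒜⟩ := (hrows _).mp ⟨i, rfl⟩
      exact ⟨fun y hy => Finset.mem_erase.mpr ⟨fun h => hxi (h ▸ hy), hSY hy⟩, hS𝒜⟩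
    · rintro ⟨hSY, hS𝒜⟩
      obtain ⟨i, rfl⟩ := (hrows S).mpr ⟨hSY.trans (Finset.erase_subset x Y), hS𝒜⟩
      exact ⟨i, fun h => Finset.notMem_erase x Y (hSY h), rfl⟩
  have hmiss : ((Y.erase x).powerset.filter fun S => ¬ (S ∉ 𝒜)) = 𝒜.filter fun A => x ∉ A := by
    ext A
    simp only [Finset.mem_filter, Finset.mem_powerset, not_not]
    constructor
    · rintro ⟨hAY, hA⟩; exact ⟨hA, fun h => Finset.notMem_erase x Y (hAY h)⟩
    · rintro ⟨hA, hxA⟩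
      exact ⟨fun y hy => Finset.mem_erase.mpr ⟨fun h => hxA (h ▸ hy), h𝒜Y A hA hy⟩, hA⟩
  rw [← Finset.card_image_of_injective _ hu, himg, ← hmiss, Finset.card_filter_add_card_filter_not,
    Finset.card_powerset, Finset.card_erase_of_mem hx]

/-- Columns avoiding `q` fill the facet up to the one excluded co-singleton: `#{k : q ∉ cols k} + [q ∈ Qs] = 2^{|Q|−1}`. -/
theorem card_cols_avoid (Q Qs : Finset (Fin K)) (q : Fin K) (hq : q ∈ Q)
    (cols : Fin r → Finset (Fin K)) (hcols : Function.Injective cols)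
    (hcolr : ∀ J, (∃ k, cols k = J) ↔ J ⊆ Q ∧ J ≠ Q ∧ ∀ q' ∈ Qs, J ≠ Q.erase q') :
    (Finset.univ.filter fun k => q ∉ cols k).card + (if q ∈ Qs then 1 else 0) = 2 ^ (Q.card - 1) := by
  classical
  have himg : (Finset.univ.filter fun k => q ∉ cols k).image cols =
      (Q.erase q).powerset.filter fun J => q ∈ Qs → J ≠ Q.erase q := by
    ext J
    simp only [Finset.mem_image, Finset.mem_filter, Finset.mem_univ, true_and, Finset.mem_powerset]
    constructor
    · rintro ⟨k, hqk, rfl⟩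
      obtain ⟨hCQ, -, hCs⟩ := (hcolr _).mp ⟨k, rfl⟩
      exact ⟨fun y hy => Finset.mem_erase.mpr ⟨fun h => hqk (h ▸ hy), hCQ hy⟩, fun hqs => hCs q hqs⟩
    · rintro ⟨hJQ, hJs⟩
      have hqJ : q ∉ J := fun h => Finset.notMem_erase q Q (hJQ h)
      have hcol : J ⊆ Q ∧ J ≠ Q ∧ ∀ q' ∈ Qs, J ≠ Q.erase q' := by
        refine ⟨hJQ.trans (Finset.erase_subset q Q), fun hEq => hqJ (hEq ▸ hq), fun q' hq' hEq => ?_⟩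
        by_cases hq'q : q' = q
        · exact hJs (hq'q ▸ hq') (hq'q ▸ hEq)
        · exact hqJ (hEq ▸ Finset.mem_erase.mpr ⟨Ne.symm hq'q, hq⟩)
      obtain ⟨k, rfl⟩ := (hcolr J).mpr hcol
      exact ⟨k, hqJ, rfl⟩
  rw [← Finset.card_image_of_injective _ hcols, himg]
  by_cases hqs : q ∈ Qs
  · rw [if_pos hqs]
    have : ((Q.erase q).powerset.filter fun J => q ∈ Qs → J ≠ Q.erase q) = (Q.erase q).powerset.erase (Q.erase q) := by
      ext J
      simp only [Finset.mem_filter, Finset.mem_erase, hqs, forall_true_left]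
      tauto
    rw [this, Finset.card_erase_of_mem (Finset.mem_powerset.mpr subset_rfl), Finset.card_powerset,
      Finset.card_erase_of_mem hq]
    have : 1 ≤ 2 ^ (Q.card - 1) := Nat.one_le_two_pow
    omega
  · rw [if_neg hqs, add_zero]
    have : ((Q.erase q).powerset.filter fun J => q ∈ Qs → J ≠ Q.erase q) = (Q.erase q).powerset := by
      ext J
      simp only [Finset.mem_filter, hqs, false_implies, and_true]
    rw [this, Finset.card_powerset, Finset.card_erase_of_mem hq]

/-! ## 4. The recursion theorem -/

/-- The case `c = 0`: the missing family is `{Y}` and the instance is the cube-minus-top tiling. -/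
theorem coStar_subcube_zero (p₀ : Fin m) (Y : Finset (Fin n)) (Q : Finset (Fin K)) (𝒜 : Finset (Finset (Fin n)))
    (u : Fin r → Finset (Fin n)) (cols : Fin r → Finset (Fin K)) (hYQ : Y.card = Q.card)
    (h𝒜Y : ∀ A ∈ 𝒜, A ⊆ Y) (hup : ∀ A ∈ 𝒜, ∀ A', A ⊆ A' → A' ⊆ Y → A' ∈ 𝒜) (h𝒜c : 𝒜.card = 1)
    (hu : Function.Injective u) (hrows : ∀ S, (∃ i, u i = S) ↔ S ⊆ Y ∧ S ∉ 𝒜)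
    (hcols : Function.Injective cols) (hcolr : ∀ k, cols k ⊆ Q ∧ cols k ≠ Q) :
    symDet u (fun k => (p₀, cols k)) ≠ 0 := by
  classical
  obtain ⟨A₀, hA₀⟩ := Finset.card_eq_one.mp h𝒜c
  have hY𝒜 : Y ∈ 𝒜 := hup A₀ (by rw [hA₀]; exact Finset.mem_singleton_self _) Y
    (h𝒜Y A₀ (by rw [hA₀]; exact Finset.mem_singleton_self _)) subset_rfl
  refine symGood_subcube_top p₀ u hu cols hcols Y Q hYQ hcolr fun S hSY hSne => (hrows S).mpr ⟨hSY, fun hS => hSne ?_⟩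
  rw [hA₀, Finset.mem_singleton] at hS hY𝒜
  rw [hS, ← hY𝒜]

/-- **THE CO-STAR RECURSION THEOREM.** See the module docstring. `cmax ≤ 3` unconditionally; `cmax = 4` given the saturated-dimension-4 fact. -/
theorem coStar_subcube_symGood (p₀ : Fin m) (cmax : ℕ)
    (hcmax : cmax ≤ 3 ∨ (cmax = 4 ∧ ∀ (Y : Finset (Fin n)) (𝒜 : Finset (Finset (Fin n))), Y.card = 4 →
      (∀ A ∈ 𝒜, A ⊆ Y) → (∀ A ∈ 𝒜, ∀ A', A ⊆ A' → A' ⊆ Y → A' ∈ 𝒜) → 𝒜.card = 5 →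
      ∃ x ∈ Y, (𝒜.filter fun A => x ∉ A).card = 1)) :
    ∀ (d : ℕ) (Y : Finset (Fin n)) (Q Qs : Finset (Fin K)) (𝒜 : Finset (Finset (Fin n))) (r : ℕ)
      (u : Fin r → Finset (Fin n)) (cols : Fin r → Finset (Fin K)),
      Y.card = d → Q.card = d → Qs ⊆ Q → Qs.card ≤ cmax →
      (∀ A ∈ 𝒜, A ⊆ Y) → (∀ A ∈ 𝒜, ∀ A', A ⊆ A' → A' ⊆ Y → A' ∈ 𝒜) → 𝒜.card = Qs.card + 1 →
      Function.Injective u → (∀ S, (∃ i, u i = S) ↔ S ⊆ Y ∧ S ∉ 𝒜) →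
      Function.Injective cols → (∀ J, (∃ k, cols k = J) ↔ J ⊆ Q ∧ J ≠ Q ∧ ∀ q ∈ Qs, J ≠ Q.erase q) →
      symDet u (fun k => (p₀, cols k)) ≠ 0 := by
  classical
  intro d
  induction d with
  | zero =>
    intro Y Q Qs 𝒜 r u cols hY hQ hQs _ h𝒜Y hup h𝒜c hu hrows hcols hcolr
    have hQe : Q = ∅ := Finset.card_eq_zero.mp hQ
    have hQse : Qs = ∅ := Finset.subset_empty.mp (hQe ▸ hQs)
    rw [hQse, Finset.card_empty, zero_add] at h𝒜c
    exact coStar_subcube_zero p₀ Y Q 𝒜 u cols (hY.trans hQ.symm) h𝒜Y hup h𝒜c hu hrows hcols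
      fun k => let h := (hcolr _).mp ⟨k, rfl⟩; ⟨h.1, h.2.1⟩
  | succ d ih =>
    intro Y Q Qs 𝒜 r u cols hY hQ hQs hcle h𝒜Y hup h𝒜c hu hrows hcols hcolr
    have hYQ : Y.card = Q.card := hY.trans hQ.symm
    have hYne : Y.Nonempty := Finset.card_pos.mp (by omega)
    -- c = 0
    by_cases hc0 : Qs = ∅
    · subst hc0
      rw [Finset.card_empty, zero_add] at h𝒜c
      exact coStar_subcube_zero p₀ Y Q 𝒜 u cols hYQ h𝒜Y hup h𝒜c hu hrows hcols
        fun k => let h := (hcolr _).mp ⟨k, rfl⟩; ⟨h.1, h.2.1⟩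
    have hQsne : Qs.Nonempty := Finset.nonempty_iff_ne_empty.mpr hc0
    by_cases hx1 : ∃ x ∈ Y, (𝒜.filter fun A => x ∉ A).card = 1
    · obtain ⟨x, hxY, hax⟩ := hx1 -- (R2′): stack on `x` with a special marker `q`
      obtain ⟨q, hqs⟩ := hQsne
      have hqQ : q ∈ Q := hQs hqs
      obtain ⟨A₁, hA₁⟩ := Finset.card_eq_one.mp hax
      have hA₁mem : A₁ ∈ 𝒜 ∧ x ∉ A₁ := by
        have : A₁ ∈ 𝒜.filter fun A => x ∉ A := by rw [hA₁]; exact Finset.mem_singleton_self _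
        exact Finset.mem_filter.mp this
      have hYx : Y.erase x ∈ 𝒜 := hup A₁ hA₁mem.1 _
        (fun y hy => Finset.mem_erase.mpr ⟨fun h => hA₁mem.2 (h ▸ hy), h𝒜Y A₁ hA₁mem.1 hy⟩) (Finset.erase_subset x Y)
      have huniq : ∀ A ∈ 𝒜, x ∉ A → A = Y.erase x := by
        intro A hA hxA
        have h1 : A ∈ 𝒜.filter fun A => x ∉ A := Finset.mem_filter.mpr ⟨hA, hxA⟩
        have h2 : Y.erase x ∈ 𝒜.filter fun A => x ∉ A := Finset.mem_filter.mpr ⟨hYx, Finset.notMem_erase x Y⟩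
        rw [hA₁, Finset.mem_singleton] at h1 h2
        rw [h1, h2]
      refine symGood_of_stack_pred p₀ u cols x q ?_ ?_ ?_
      · have h1 := card_rows_avoid Y 𝒜 x hxY h𝒜Y u hu hrows
        have h2 := card_cols_avoid Q Qs q hqQ cols hcols hcolr
        rw [hax, hY] at h1
        rw [if_pos hqs, hQ] at h2
        omega
      · intro r₀ f g hf hg hfx hfs hgq _
        refine symGood_subcube_top p₀ _ (hu.comp hf) _ (hcols.comp hg) (Y.erase x) (Q.erase q) ?_ ?_ ?_
        · rw [Finset.card_erase_of_mem hxY, Finset.card_erase_of_mem hqQ, hYQ]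
        · intro j
          obtain ⟨hCQ, -, hCs⟩ := (hcolr _).mp ⟨g j, rfl⟩
          exact ⟨fun y hy => Finset.mem_erase.mpr ⟨fun h => hgq j (h ▸ hy), hCQ hy⟩, hCs q hqs⟩
        · intro S hSY hSne
          have hxS : x ∉ S := fun h => Finset.notMem_erase x Y (hSY h)
          obtain ⟨i, hi⟩ := (hrows S).mpr ⟨hSY.trans (Finset.erase_subset x Y), fun hS => hSne (huniq S hS hxS)⟩
          obtain ⟨j, rfl⟩ := hfs i (hi ▸ hxS)
          exact ⟨j, hi⟩
      · intro r₁ f g hf hg hfx hfs hgq hgs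
        obtain ⟨hinj, hran⟩ := linkRows_range Y 𝒜 x hxY u hu hrows f hf hfx hfs
        obtain ⟨hcinj, hcran⟩ := linkCols_range Q Qs q hqQ cols hcols hcolr g hg hgq hgs
        have hfilt : (𝒜.filter fun A => x ∈ A).card = Qs.card := by
          have := Finset.card_filter_add_card_filter_not (s := 𝒜) (fun A => x ∈ A); rw [hax, h𝒜c] at this; omega
        refine ih (Y.erase x) (Q.erase q) (Qs.erase q) ((𝒜.filter fun A => x ∈ A).image fun A => A.erase x) r₁
          (fun j => (u (f j)).erase x) (fun j => (cols (g j)).erase q) ?_ ?_ ?_ ?_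
          (linkFamily_subset Y 𝒜 x h𝒜Y) (linkFamily_up Y 𝒜 x hxY hup) ?_ hinj hran hcinj hcran
        · rw [Finset.card_erase_of_mem hxY, hY]; rfl
        · rw [Finset.card_erase_of_mem hqQ, hQ]; rfl
        · exact Finset.erase_subset_erase q hQs
        · rw [Finset.card_erase_of_mem hqs]; omega
        · rw [linkFamily_card, hfilt, Finset.card_erase_of_mem hqs]
          have := Finset.card_pos.mpr ⟨q, hqs⟩
          omega
    · push Not at hx1
      by_cases hsat : Qs = Q
      · by_cases hd3 : d + 1 ≤ 3 -- saturated: `c = d`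
        · -- free leaf: every column has at most one state
          refine symGood_of_cols_card_le_one p₀ u hu cols hcols fun k => ?_ -- free leaf: |column| ≤ 1
          obtain ⟨hCQ, hCne, hCs⟩ := (hcolr _).mp ⟨k, rfl⟩
          rw [hsat] at hCs
          have h2 : 2 ≤ (Q \ cols k).card := by
            by_contra hlt
            push Not at hlt
            interval_cases hsd : (Q \ cols k).card
            · apply hCne
              exact (Finset.eq_of_subset_of_card_le hCQ (by
                have := Finset.card_sdiff_add_card_eq_card hCQ; omega)).symm ▸ rfl
            · obtain ⟨q, hq⟩ := Finset.card_eq_one.mp hsd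
              have hqm : q ∈ Q \ cols k := by rw [hq]; exact Finset.mem_singleton_self _
              apply hCs q (Finset.mem_sdiff.mp hqm).1
              ext y
              simp only [Finset.mem_erase]
              constructor
              · exact fun hy => ⟨fun h => (Finset.mem_sdiff.mp hqm).2 (h ▸ hy), hCQ hy⟩
              · rintro ⟨hyq, hyQ⟩
                by_contra hyC
                have : y ∈ Q \ cols k := Finset.mem_sdiff.mpr ⟨hyQ, hyC⟩
                rw [hq, Finset.mem_singleton] at this
                exact hyq this
          have := Finset.card_sdiff_add_card_eq_card hCQ
          omega
        · exfalso
          have hcQ : Qs.card = d + 1 := by rw [hsat, hQ]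
          rcases hcmax with hc3 | ⟨hc4, H4⟩
          · omega
          · have hd4 : d + 1 = 4 := by omega
            obtain ⟨x, hxY, hx⟩ := H4 Y 𝒜 (hY.trans hd4) h𝒜Y hup (by rw [h𝒜c, hcQ, hd4])
            exact hx1 x hxY hx
      · -- (R1): a coordinate in every missing row, a non-special marker
        obtain ⟨q₀, hq₀Q, hq₀s⟩ := Finset.exists_of_ssubset (Finset.ssubset_iff_subset_ne.mpr ⟨hQs, hsat⟩)
        obtain ⟨x, hxY, hax⟩ := exists_coord_avoid_le_one Y 𝒜 h𝒜Y hup (Finset.card_pos.mp (by omega))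
          (by rw [h𝒜c, hYQ]; have := Finset.card_le_card hQs; omega) hYne
        have hax0 : (𝒜.filter fun A => x ∉ A).card = 0 := by have := hx1 x hxY; omega
        have hall : ∀ A ∈ 𝒜, x ∈ A := fun A hA => by
          by_contra hxA
          have : A ∈ 𝒜.filter fun A => x ∉ A := Finset.mem_filter.mpr ⟨hA, hxA⟩
          rw [Finset.card_eq_zero.mp hax0] at this; exact Finset.notMem_empty A this
        refine symGood_of_stack_pred p₀ u cols x q₀ ?_ ?_ ?_
        · have h1 := card_rows_avoid Y 𝒜 x hxY h𝒜Y u hu hrows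
          have h2 := card_cols_avoid Q Qs q₀ hq₀Q cols hcols hcolr
          rw [hax0, hY] at h1
          rw [if_neg hq₀s, hQ] at h2
          omega
        · intro r₀ f g hf hg hfx hfs hgq _
          refine symGood_subcube_full p₀ _ (hu.comp hf) _ (hcols.comp hg) (Y.erase x) (Q.erase q₀) ?_ ?_ ?_
          · rw [Finset.card_erase_of_mem hxY, Finset.card_erase_of_mem hq₀Q, hYQ]
          · intro j
            obtain ⟨hCQ, -, -⟩ := (hcolr _).mp ⟨g j, rfl⟩
            exact fun y hy => Finset.mem_erase.mpr ⟨fun h => hgq j (h ▸ hy), hCQ hy⟩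
          · intro S hSY
            have hxS : x ∉ S := fun h => Finset.notMem_erase x Y (hSY h)
            obtain ⟨i, hi⟩ := (hrows S).mpr ⟨hSY.trans (Finset.erase_subset x Y), fun hS => hxS (hall S hS)⟩
            obtain ⟨j, rfl⟩ := hfs i (hi ▸ hxS)
            exact ⟨j, hi⟩
        · intro r₁ f g hf hg hfx hfs hgq hgs
          obtain ⟨hinj, hran⟩ := linkRows_range Y 𝒜 x hxY u hu hrows f hf hfx hfs
          obtain ⟨hcinj, hcran⟩ := linkCols_range Q Qs q₀ hq₀Q cols hcols hcolr g hg hgq hgs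
          rw [Finset.erase_eq_of_notMem hq₀s] at hcran
          have hfilt : (𝒜.filter fun A => x ∈ A).card = Qs.card + 1 := by
            rw [Finset.filter_true_of_mem hall, h𝒜c]
          refine ih (Y.erase x) (Q.erase q₀) Qs ((𝒜.filter fun A => x ∈ A).image fun A => A.erase x) r₁
            (fun j => (u (f j)).erase x) (fun j => (cols (g j)).erase q₀) ?_ ?_ ?_ hcle
            (linkFamily_subset Y 𝒜 x h𝒜Y) (linkFamily_up Y 𝒜 x hxY hup) ?_ hinj hran hcinj hcran
          · rw [Finset.card_erase_of_mem hxY, hY]; rfl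
          · rw [Finset.card_erase_of_mem hq₀Q, hQ]; rfl
          · exact Finset.subset_erase.mpr ⟨hQs, hq₀s⟩
          · rw [linkFamily_card, hfilt]

end SymbJoin

end

end Summit.ValiantsHypothesis.ValiantsHypothesis.Theorems.BarrierLever.HiddenStates
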